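import Mathlib
import HarnessLib

/-!
# LatticeQCDFlow / Scaling — the Gamma/scale annealing model: per-layer cost `f(u) = log(ρ²/(2ρ−1))`, optimality of the geometric protocol, and the `log² R / n` law (C6, model half)

HONEST FRAMING: exact (Metropolis-corrected) sampling algorithms for lattice gauge theory; figures of merit are
autocorrelation/cost numbers at stated couplings and volumes; no continuum-physics claim.

Venture `LatticeQCDFlow` (cell pub-lqcd), topic `Scaling`, FANOUT row 30 (lean-1) — OUR WORK, the "routine
computation … not formalised" half of THEORY-2.md §4 row C6 (v2.5, §3.5 (ix)).  In the factorised Gamma/scale model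
of an annealing-type exact sampler with PERFECT relaxation (single-site laws `p_β(x) ∝ x^{k-1}e^{-βx}` on `(0,∞)`,
`Z(β) = Γ(k)β^{-k}`, `k = n_dof/2`, `m` independent sites, intermediate couplings `β₀ < β₁ < ⋯ < β_n = R·β₀`), the
tree's telescoping identity (`Scaling/PerfectRelaxationTelescoping.lean`) makes `-log ÊSS = m·k·Σ_j f(u_j)` with
`u_j = log(β_j/β_{j-1})`, `Σ_j u_j = log R`, and the PER-LAYER COST

  `f(u) = 2u - log(2e^u - 1) = log(ρ²/(2ρ - 1))`, `ρ = e^u`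

(the `χ²`-divergence of consecutive Gamma laws: `∫ p_{β'}²/p_β = (β'²/(β(2β' - β)))^k`, §3).  This file proves:

* §1 `layerCost`, `layerCost_zero`, `hasDerivAt_layerCost` (`f'(u) = 1 - 1/(2e^u - 1)`), `monotoneOn_deriv_layerCost`,
  **`convexOn_layerCost`** (`f` is convex on `[0, ∞)`), `layerCost_nonneg`;
* §2 **`sum_layerCost_ge`** — OPTIMALITY OF THE GEOMETRIC PROTOCOL: for every protocol `u₁, …, u_n ≥ 0` with
  `Σ u_j = U` (`= log R`), `Σ_j f(u_j) ≥ n·f(U/n)` (Jensen), with equality for the geometric protocol `u_j = U/n`;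
  **`layerCost_le_sq`** (`f(u) ≤ u²` on `u ≥ 0`), hence **`geometric_cost_le`**: the geometric protocol pays
  `n·f(U/n) ≤ U²/n` — the `-log ÊSS ≤ m·k·log²R/n` law: `n ≥ m·k·log²R/t` layers give `ÊSS ≥ e^{-t}` in the model;
* §3 `integral_gammaPDFReal_sq_div` (with `gammaPDFReal_sq_div`) — the Gamma computation behind `f`: for `0 < β < 2β'`,
  `∫₀^∞ p_{β'}(x)²/p_β(x) dx = (β'²/(β(2β' - β)))^k` (Mathlib `integral_rpow_mul_exp_neg_mul_Ioi`), i.e.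
  `-log ESS(p_{β'}, p_β) = k·f(log(β'/β))`.

The LATTICE lower bound of C6 (`n ≥ c(N²-1)L^d·min{log²(β/β₀)/t, log(β/β₀)}` for sitewise-monotone layers) is the
conjecture and is NOT touched here.  Elementary real analysis; nothing is cited as a fact.
-/

noncomputable section

namespace Summit.Ventures.LatticeQCDFlow.Theory2

open Real Set MeasureTheory Finset

/-! ## §1. The per-layer cost `f(u) = 2u − log(2e^u − 1)` -/

/-- **Per-layer cost of the Gamma/scale model**: `f(u) = 2u − log(2e^u − 1) = log(ρ²/(2ρ−1))`, `ρ = e^u` the ratio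
of consecutive couplings. [folklore] -/
def layerCost (u : ℝ) : ℝ := 2 * u - Real.log (2 * Real.exp u - 1)

/-- `2e^u − 1 ≥ 1` for `u ≥ 0`. [folklore] -/
theorem one_le_two_mul_exp_sub_one {u : ℝ} (hu : 0 ≤ u) : 1 ≤ 2 * Real.exp u - 1 := by
  have := Real.one_le_exp hu
  linarith

/-- `f(0) = 0`: a layer with no coupling change costs nothing. [folklore] -/
theorem layerCost_zero : layerCost 0 = 0 := by
  rw [layerCost, Real.exp_zero]
  norm_num

/-- `f(u) = log(e^{2u}/(2e^u − 1))`. [folklore] -/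
theorem layerCost_eq_log {u : ℝ} (hu : 0 ≤ u) :
    layerCost u = Real.log (Real.exp u ^ 2 / (2 * Real.exp u - 1)) := by
  have h1 : 0 < 2 * Real.exp u - 1 := by linarith [one_le_two_mul_exp_sub_one hu]
  rw [layerCost, Real.log_div (pow_pos (Real.exp_pos u) 2).ne' h1.ne', Real.log_pow, Real.log_exp]
  ring

/-- `f ≥ 0` on `u ≥ 0`. [folklore] -/
theorem layerCost_nonneg {u : ℝ} (hu : 0 ≤ u) : 0 ≤ layerCost u := by
  rw [layerCost_eq_log hu]
  apply Real.log_nonneg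
  have h1 : 0 < 2 * Real.exp u - 1 := by linarith [one_le_two_mul_exp_sub_one hu]
  rw [le_div_iff₀ h1, one_mul]
  nlinarith [Real.exp_pos u, sq_nonneg (Real.exp u - 1)]

/-- **`f'(u) = 1 − 1/(2e^u − 1)`** (for `2e^u − 1 > 0`). [folklore] -/
theorem hasDerivAt_layerCost {u : ℝ} (hu : 0 < 2 * Real.exp u - 1) :
    HasDerivAt layerCost (1 - 1 / (2 * Real.exp u - 1)) u := by
  have h1 : HasDerivAt (fun u => 2 * Real.exp u - 1) (2 * Real.exp u) u := by
    simpa using ((Real.hasDerivAt_exp u).const_mul 2).sub_const 1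
  have h2 : HasDerivAt (fun u => Real.log (2 * Real.exp u - 1)) (2 * Real.exp u / (2 * Real.exp u - 1)) u :=
    h1.log hu.ne'
  have h3 : HasDerivAt (fun u : ℝ => 2 * u) 2 u := by simpa using (hasDerivAt_id u).const_mul 2
  have h := h3.sub h2
  have he : (2 : ℝ) - 2 * Real.exp u / (2 * Real.exp u - 1) = 1 - 1 / (2 * Real.exp u - 1) := by
    field_simp
    ring
  rw [he] at h
  exact h

/-- The derivative of `f` on `[0, ∞)`. [folklore] -/
theorem deriv_layerCost {u : ℝ} (hu : 0 ≤ u) : deriv layerCost u = 1 - 1 / (2 * Real.exp u - 1) :=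
  (hasDerivAt_layerCost (by linarith [one_le_two_mul_exp_sub_one hu])).deriv

/-- `f` is differentiable on `[0, ∞)`. [folklore] -/
theorem differentiableAt_layerCost {u : ℝ} (hu : 0 ≤ u) : DifferentiableAt ℝ layerCost u :=
  (hasDerivAt_layerCost (by linarith [one_le_two_mul_exp_sub_one hu])).differentiableAt

/-- `f'` is monotone on `[0, ∞)` (`2e^u − 1` increases). [folklore] -/
theorem monotoneOn_deriv_layerCost : MonotoneOn (deriv layerCost) (Ici 0) := by
  intro u (hu : 0 ≤ u) w (hw : 0 ≤ w) huw
  rw [deriv_layerCost hu, deriv_layerCost hw]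
  have h1 : 1 ≤ 2 * Real.exp u - 1 := one_le_two_mul_exp_sub_one hu
  have h2 : 2 * Real.exp u - 1 ≤ 2 * Real.exp w - 1 := by linarith [Real.exp_le_exp.2 huw]
  have := one_div_le_one_div_of_le (by linarith) h2
  linarith

/-- **`f` is convex on `[0, ∞)`.** [folklore] -/
theorem convexOn_layerCost : ConvexOn ℝ (Ici (0 : ℝ)) layerCost := by
  refine MonotoneOn.convexOn_of_deriv (convex_Ici 0) ?_ ?_ ?_
  · exact fun u hu => (differentiableAt_layerCost hu).continuousAt.continuousWithinAt
  · intro u hu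
    rw [interior_Ici] at hu
    exact (differentiableAt_layerCost (le_of_lt hu)).differentiableWithinAt
  · rw [interior_Ici]
    exact monotoneOn_deriv_layerCost.mono Ioi_subset_Ici_self

/-! ## §2. Optimality of the geometric protocol and the `log² R / n` law -/

/-- **Optimality of the geometric protocol** (Jensen): for every protocol `u₁, …, u_n ≥ 0` of total `U = Σ u_j`
(`= log R`), `n·f(U/n) ≤ Σ_j f(u_j)` — equal coupling RATIOS minimise the total cost `-log ÊSS / (m·k)`. [folklore] -/
theorem sum_layerCost_ge {n : ℕ} (hn : 0 < n) (u : Fin n → ℝ) (hu : ∀ j, 0 ≤ u j) :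
    (n : ℝ) * layerCost ((∑ j, u j) / n) ≤ ∑ j, layerCost (u j) := by
  have hn' : (0 : ℝ) < n := by exact_mod_cast hn
  have hJ := convexOn_layerCost.map_sum_le (t := Finset.univ) (w := fun _ : Fin n => (1 : ℝ) / n) (p := u)
    (fun _ _ => by positivity)
    (by rw [Finset.sum_const, Finset.card_univ, Fintype.card_fin, nsmul_eq_mul]; field_simp)
    (fun j _ => hu j)
  have h1 : ∑ j, ((1 : ℝ) / n) • u j = (∑ j, u j) / n := by
    rw [← Finset.smul_sum, smul_eq_mul]; ring
  have h2 : ∑ j, ((1 : ℝ) / n) • layerCost (u j) = (∑ j, layerCost (u j)) / n := by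
    rw [← Finset.smul_sum, smul_eq_mul]; ring
  rw [h1, h2, le_div_iff₀ hn'] at hJ
  linarith

/-- The derivative of `u² − f(u)` is non-negative on `[0, ∞)`: `2u − 1 + 1/(2e^u − 1) ≥ 0`. [folklore] -/
theorem deriv_sq_sub_layerCost_nonneg {u : ℝ} (hu : 0 ≤ u) : 0 ≤ 2 * u - (1 - 1 / (2 * Real.exp u - 1)) := by
  have h1 : 1 ≤ 2 * Real.exp u - 1 := one_le_two_mul_exp_sub_one hu
  have h1' : 0 < 2 * Real.exp u - 1 := by linarith
  rcases le_or_gt (1 / 2 : ℝ) u with hu2 | hu2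
  · have : 0 ≤ 1 / (2 * Real.exp u - 1) := by positivity
    linarith
  · -- `0 ≤ u < 1/2`: `(1 − 2u)(2e^u − 1) ≤ 1` from `e^u (1 − u) ≤ 1` and `u·e^u ≥ u`
    have h3 : Real.exp u * (1 - u) ≤ 1 := by
      have h := Real.add_one_le_exp (-u)
      have h2 : Real.exp u * Real.exp (-u) = 1 := by rw [← Real.exp_add, add_neg_cancel, Real.exp_zero]
      nlinarith [Real.exp_pos u]
    have h4 : u ≤ u * Real.exp u := le_mul_of_one_le_right hu (Real.one_le_exp hu)
    have h5 : (1 - 2 * u) * (2 * Real.exp u - 1) ≤ 1 := by nlinarith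
    have h6 : 1 - 2 * u ≤ 1 / (2 * Real.exp u - 1) := by
      rw [le_div_iff₀ h1']; exact h5
    linarith

/-- **`f(u) ≤ u²` on `u ≥ 0`** (the geometric protocol's cost is at most quadratic in the log-ratio). [folklore] -/
theorem layerCost_le_sq {u : ℝ} (hu : 0 ≤ u) : layerCost u ≤ u ^ 2 := by
  -- `g(u) = u² − f(u)` is monotone on `[0, ∞)` with `g(0) = 0`
  have hmono : MonotoneOn (fun u => u ^ 2 - layerCost u) (Ici 0) := by
    refine monotoneOn_of_deriv_nonneg (convex_Ici 0) ?_ ?_ ?_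
    · exact fun u hu => ((continuous_pow 2).continuousAt.sub
        (differentiableAt_layerCost hu).continuousAt).continuousWithinAt
    · intro u hu
      rw [interior_Ici] at hu
      exact ((differentiableAt_pow 2).sub (differentiableAt_layerCost (le_of_lt hu))).differentiableWithinAt
    · intro u hu
      rw [interior_Ici] at hu
      have hu' : 0 ≤ u := le_of_lt hu
      have hd : HasDerivAt (fun u => u ^ 2 - layerCost u) (2 * u - (1 - 1 / (2 * Real.exp u - 1))) u := by
        have h1 : HasDerivAt (fun u : ℝ => u ^ 2) (2 * u) u := by simpa using hasDerivAt_pow 2 u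
        exact h1.sub (hasDerivAt_layerCost (by linarith [one_le_two_mul_exp_sub_one hu']))
      rw [hd.deriv]
      exact deriv_sq_sub_layerCost_nonneg hu'
  have h := hmono (self_mem_Ici) hu hu
  simp only [layerCost_zero, sub_zero] at h
  have : (0 : ℝ) ^ 2 = 0 := by norm_num
  linarith

/-- **The `log² R / n` law of the geometric protocol**: `n` equal log-steps of total `U = log R ≥ 0` cost
`n·f(U/n) ≤ U²/n`; in the model `-log ÊSS = m·k·n·f(log R/n) ≤ m·k·log²R/n`, so `n ≥ m·k·log²R/t` layers give
`ÊSS ≥ e^{-t}`. [folklore] -/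
theorem geometric_cost_le {n : ℕ} (hn : 0 < n) {U : ℝ} (hU : 0 ≤ U) :
    (n : ℝ) * layerCost (U / n) ≤ U ^ 2 / n := by
  have hn' : (0 : ℝ) < n := by exact_mod_cast hn
  have h := layerCost_le_sq (div_nonneg hU hn'.le)
  calc (n : ℝ) * layerCost (U / n) ≤ n * (U / n) ^ 2 := mul_le_mul_of_nonneg_left h hn'.le
    _ = U ^ 2 / n := by field_simp

/-! ## §3. The Gamma computation behind `f`: `∫ p_{β'}²/p_β = (β'²/(β(2β' − β)))^k` -/

open ProbabilityTheory in
/-- The integrand: for `x > 0`, `p_{β'}(x)²/p_β(x) = (β'^k)²/(β^k·Γ(k)) · x^{k−1}·e^{−(2β'−β)x}` (Gamma laws of shape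
`k`, rates `β, β'`). [folklore] -/
theorem gammaPDFReal_sq_div {k β β' x : ℝ} (hk : 0 < k) (hβ : 0 < β) (hx : 0 < x) :
    gammaPDFReal k β' x ^ 2 / gammaPDFReal k β x =
      (β' ^ k) ^ 2 / (β ^ k * Real.Gamma k) * (x ^ (k - 1) * Real.exp (-((2 * β' - β) * x))) := by
  rw [gammaPDFReal, gammaPDFReal, if_pos hx.le, if_pos hx.le]
  have hG : Real.Gamma k ≠ 0 := (Real.Gamma_pos_of_pos hk).ne'
  have hxk : x ^ (k - 1) ≠ 0 := (Real.rpow_pos_of_pos hx _).ne'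
  have hβk : β ^ k ≠ 0 := (Real.rpow_pos_of_pos hβ _).ne'
  have hex : Real.exp (-(β * x)) ≠ 0 := (Real.exp_pos _).ne'
  have hexp : Real.exp (-(β' * x)) ^ 2 = Real.exp (-((2 * β' - β) * x)) * Real.exp (-(β * x)) := by
    rw [sq, ← Real.exp_add, ← Real.exp_add]; congr 1; ring
  rw [mul_pow, mul_pow, div_pow, hexp]
  field_simp

open ProbabilityTheory in
/-- **`χ²` of consecutive Gamma laws**: for shape `k > 0` and rates `0 < β < 2β'`,
`∫₀^∞ p_{β'}(x)²/p_β(x) dx = (β'²/(β(2β' − β)))^k`; hence `ESS(p_{β'}, p_β) = (β(2β'−β)/β'²)^k` and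
`-log ESS = k·f(log(β'/β))` with `f = layerCost`. [folklore] -/
theorem integral_gammaPDFReal_sq_div {k β β' : ℝ} (hk : 0 < k) (hβ : 0 < β) (hβ' : β < 2 * β') :
    ∫ x in Ioi 0, gammaPDFReal k β' x ^ 2 / gammaPDFReal k β x = (β' ^ 2 / (β * (2 * β' - β))) ^ k := by
  have hβ'0 : 0 < β' := by linarith
  have hc : 0 < 2 * β' - β := by linarith
  rw [setIntegral_congr_fun measurableSet_Ioi (fun x (hx : 0 < x) => gammaPDFReal_sq_div hk hβ hx),
    integral_const_mul, Real.integral_rpow_mul_exp_neg_mul_Ioi hk hc]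
  have hG : Real.Gamma k ≠ 0 := (Real.Gamma_pos_of_pos hk).ne'
  have h1 : (β' ^ k) ^ 2 = (β' ^ 2) ^ k := by
    rw [← Real.rpow_mul_natCast hβ'0.le, ← Real.rpow_natCast_mul hβ'0.le]; congr 1; push_cast; ring
  rw [h1, Real.div_rpow zero_le_one hc.le, Real.one_rpow,
    Real.div_rpow (sq_nonneg β') (mul_nonneg hβ.le hc.le), Real.mul_rpow hβ.le hc.le]
  have hck : (2 * β' - β) ^ k ≠ 0 := (Real.rpow_pos_of_pos hc _).ne'
  have hβk : β ^ k ≠ 0 := (Real.rpow_pos_of_pos hβ _).ne'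
  field_simp

end Summit.Ventures.LatticeQCDFlow.Theory2

end
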